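import Summits.CriticalPhenomena.PercolationContinuityZ3.Theorems.PercNearOneGluingNoHeavyLowerTailSahiCombTriWUncrossing

/-!
# The PAIRING BOUND for the crossing terms of `TRI_W(2)`: the deficit sits on `P ∖ refl P`

Support file of the one-cut programme (crux `NoHeavyLowerTail`, stmt-CriticalPhenomena-4575; TRI lane of cell `prim-masterthm`; seat prim-lf-1 gen 38,
memo `FROM-prim-lf-1-gen38-AN3-KERNEL.md` §6).  By `triW_ge_cross` (`…TriWUncrossing`), `triW P F G ≥ X_a + X_b` with the crossing terms
`X(U,V) = 2#(P∩U∩V) + #(P∩refl U∩V) + #(P∩U∩refl V) − 2#(P∩refl U∩refl V)` at `(U,V) = (F{a}∖F{b}, G{a}∖G{b})` and `(F{b}∖F{a}, G{b}∖G{a})`.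
Writing `X(U,V) = Σ_{e∈P} x(e)` with `x(e) = 2uv + u'v + uv' − 2u'v'` (`u = [e∈U]`, `u' = [eᶜ∈U]`, …) and PAIRING `e` with `eᶜ` on the antipodally closed
part `P ∩ refl P` (where `x(e) + x(eᶜ) = 2(u'v + uv') ≥ 0`) shows that only the points of `P ∖ refl P` whose complement is a DOUBLE CROSSING contribute
negatively:

* **`FiveUpSet.cross_ge_neg_two_card`** — `X(U,V) ≥ −2·#((P ∖ refl P) ∩ refl U ∩ refl V)` for all finsets `P, U, V`;
* **`FiveUpSet.triW_ge_neg_two_card_deficit`** — `triW P F G ≥ −2·#((P∖refl P) ∩ refl D_a) − 2·#((P∖refl P) ∩ refl D_b)` (`D_a = (F{a}∖F{b})∩(G{a}∖G{b})`, …)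
  for monotone families of up-sets over a two-atom index cube and every up-set `P`;
* **`FiveUpSet.triW_nonneg_of_deficit_free`** — if every `e ∈ P` whose complement is a double crossing has its complement in `P`
  (`P ∩ refl D_a ⊆ refl P` and `P ∩ refl D_b ⊆ refl P`), then `0 ≤ triW P F G`.  This single stratum CONTAINS the refl-closed stratum `refl P ⊆ P`
  (`…TriWShell.triW_nonneg_of_refl_subset`, then `P ⊆ refl P`), the crossing-free stratum and `triW_nonneg_of_refl_crossings_disjoint` (`…TriWUncrossing`).
So the open core of `TriWIneq` at `a = 2` is: absorb `2·#{e ∈ P : eᶜ ∉ P, eᶜ ∈ D_a ∪ D_b}` (memo §6–§7, conjecture CORE).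
HONEST LABEL: elementary (pairing under the antipode) on top of `triW_ge_cross`; std axioms. [this work]
-/

namespace Summit.CriticalPhenomena.PercolationContinuityZ3.Theorems

namespace FiveUpSet

open Finset LatticeFiveUpSet

variable {γ : Type} [DecidableEq γ] [Fintype γ]

/-- **Pairing bound for one crossing term.**  For all finsets `P, U, V` of the cube:
`2#(P∩U∩V) + #(P∩refl U∩V) + #(P∩U∩refl V) − 2#(P∩refl U∩refl V) ≥ −2·#((P ∖ refl P) ∩ refl U ∩ refl V)`. [this work] -/
theorem cross_ge_neg_two_card (P U V : Finset (Finset γ)) :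
    -2 * (((P \ refl P) ∩ refl U ∩ refl V).card : ℤ)
      ≤ 2 * ((P ∩ U ∩ V).card : ℤ) + (P ∩ refl U ∩ V).card + (P ∩ U ∩ refl V).card - 2 * ((P ∩ refl U ∩ refl V).card : ℤ) := by
  -- pointwise summand
  set x : Finset γ → ℤ := fun e =>
    2 * ((if e ∈ U then (1 : ℤ) else 0) * (if e ∈ V then (1 : ℤ) else 0))
      + (if eᶜ ∈ U then (1 : ℤ) else 0) * (if e ∈ V then (1 : ℤ) else 0)
      + (if e ∈ U then (1 : ℤ) else 0) * (if eᶜ ∈ V then (1 : ℤ) else 0)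
      - 2 * ((if eᶜ ∈ U then (1 : ℤ) else 0) * (if eᶜ ∈ V then (1 : ℤ) else 0)) with hx
  have hX : 2 * ((P ∩ U ∩ V).card : ℤ) + (P ∩ refl U ∩ V).card + (P ∩ U ∩ refl V).card - 2 * ((P ∩ refl U ∩ refl V).card : ℤ)
      = ∑ e ∈ P, x e := by
    simp only [hx, card_inter_inter_eq_sum_ite, mem_refl, Finset.sum_add_distrib, Finset.sum_sub_distrib, Finset.mul_sum]
  -- split `P` into the antipodally closed part `A` and the rest `B = P \ refl P`
  set A : Finset (Finset γ) := P.filter (fun e => eᶜ ∈ P) with hA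
  set B : Finset (Finset γ) := P.filter (fun e => ¬ eᶜ ∈ P) with hB
  have hsplit : ∑ e ∈ P, x e = ∑ e ∈ A, x e + ∑ e ∈ B, x e := (Finset.sum_filter_add_sum_filter_not P (fun e => eᶜ ∈ P) x).symm
  -- on `A` the involution `e ↦ eᶜ` pairs the summands: `x e + x eᶜ ≥ 0`
  have hAinv : ∑ e ∈ A, x e = ∑ e ∈ A, x eᶜ := by
    refine Finset.sum_nbij' (fun e => eᶜ) (fun e => eᶜ) ?_ ?_ ?_ ?_ ?_
    · intro e he
      rw [hA, mem_filter] at he ⊢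
      exact ⟨he.2, by rw [compl_compl]; exact he.1⟩
    · intro e he
      rw [hA, mem_filter] at he ⊢
      exact ⟨he.2, by rw [compl_compl]; exact he.1⟩
    · intro e _; exact compl_compl e
    · intro e _; exact compl_compl e
    · intro e _; rw [compl_compl]
  have hApos : 0 ≤ ∑ e ∈ A, x e := by
    have h2 : 2 * ∑ e ∈ A, x e = ∑ e ∈ A, (x e + x eᶜ) := by rw [two_mul, Finset.sum_add_distrib, ← hAinv]
    have h3 : 0 ≤ ∑ e ∈ A, (x e + x eᶜ) := by
      refine Finset.sum_nonneg fun e _ => ?_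
      simp only [hx, compl_compl]
      by_cases h1 : e ∈ U <;> by_cases h2 : eᶜ ∈ U <;> by_cases h3 : e ∈ V <;> by_cases h4 : eᶜ ∈ V <;> simp [h1, h2, h3, h4]
    linarith
  -- on `B` each summand is at least `−2·[eᶜ ∈ U][eᶜ ∈ V]`
  have hBge : -2 * (((P \ refl P) ∩ refl U ∩ refl V).card : ℤ) ≤ ∑ e ∈ B, x e := by
    have hBeq : P \ refl P = B := by
      ext e; rw [hB, mem_sdiff, mem_filter, mem_refl]
    rw [hBeq, card_inter_inter_eq_sum_ite, Finset.mul_sum]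
    refine Finset.sum_le_sum fun e _ => ?_
    simp only [hx, mem_refl]
    by_cases h1 : e ∈ U <;> by_cases h2 : eᶜ ∈ U <;> by_cases h3 : e ∈ V <;> by_cases h4 : eᶜ ∈ V <;> simp [h1, h2, h3, h4]
  rw [hX, hsplit]
  linarith

/-- **The deficit bound for `TRI_W(2)`.**  For monotone families of up-sets `F, G` over a two-atom index cube `univ = {a,b}` and every up-set `P`:
`triW P F G ≥ −2·#((P ∖ refl P) ∩ refl D_a) − 2·#((P ∖ refl P) ∩ refl D_b)`, `D_a = (F{a}∖F{b}) ∩ (G{a}∖G{b})`, `D_b = (F{b}∖F{a}) ∩ (G{b}∖G{a})`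
(`triW_ge_cross` + the pairing bound). [this work] -/
theorem triW_ge_neg_two_card_deficit {β : Type} [DecidableEq β] [Fintype β] {a b : β} (hab : a ≠ b) (hu : (univ : Finset β) = {a, b})
    (P : Finset (Finset γ)) (F G : Finset β → Finset (Finset γ))
    (hP : IsUpperSet (P : Set (Finset γ))) (hF : ∀ x, IsUpperSet (F x : Set (Finset γ))) (hG : ∀ x, IsUpperSet (G x : Set (Finset γ)))
    (hFm : Monotone F) (hGm : Monotone G) :
    -2 * (((P \ refl P) ∩ refl ((F {a} \ F {b}) ∩ (G {a} \ G {b}))).card : ℤ)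
        - 2 * (((P \ refl P) ∩ refl ((F {b} \ F {a}) ∩ (G {b} \ G {a}))).card : ℤ) ≤ triW P F G := by
  have h := triW_ge_cross hab hu P F G hP hF hG hFm hGm
  have ha := cross_ge_neg_two_card P (F {a} \ F {b}) (G {a} \ G {b})
  have hb := cross_ge_neg_two_card P (F {b} \ F {a}) (G {b} \ G {a})
  have ea : (P \ refl P) ∩ refl (F {a} \ F {b}) ∩ refl (G {a} \ G {b}) = (P \ refl P) ∩ refl ((F {a} \ F {b}) ∩ (G {a} \ G {b})) := by
    rw [refl_inter, inter_assoc]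
  have eb : (P \ refl P) ∩ refl (F {b} \ F {a}) ∩ refl (G {b} \ G {a}) = (P \ refl P) ∩ refl ((F {b} \ F {a}) ∩ (G {b} \ G {a})) := by
    rw [refl_inter, inter_assoc]
  rw [ea] at ha
  rw [eb] at hb
  linarith

/-- **The DEFICIT-FREE stratum of `TRI_W(2)` (unconditional).**  If every point of `P` whose complement is a double crossing has its complement in `P`
(`P ∩ refl D_a ⊆ refl P` and `P ∩ refl D_b ⊆ refl P`), then `0 ≤ triW P F G`.  Contains the refl-closed stratum (`refl P ⊆ P` forces `P ⊆ refl P`),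
the crossing-free stratum (`D_a = D_b = ∅`) and the disjoint case `P ∩ refl D = ∅`. [this work] -/
theorem triW_nonneg_of_deficit_free {β : Type} [DecidableEq β] [Fintype β] {a b : β} (hab : a ≠ b) (hu : (univ : Finset β) = {a, b})
    (P : Finset (Finset γ)) (F G : Finset β → Finset (Finset γ))
    (hP : IsUpperSet (P : Set (Finset γ))) (hF : ∀ x, IsUpperSet (F x : Set (Finset γ))) (hG : ∀ x, IsUpperSet (G x : Set (Finset γ)))
    (hFm : Monotone F) (hGm : Monotone G)
    (hDa : P ∩ refl ((F {a} \ F {b}) ∩ (G {a} \ G {b})) ⊆ refl P) (hDb : P ∩ refl ((F {b} \ F {a}) ∩ (G {b} \ G {a})) ⊆ refl P) :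
    0 ≤ triW P F G := by
  have h := triW_ge_neg_two_card_deficit hab hu P F G hP hF hG hFm hGm
  have ea : (P \ refl P) ∩ refl ((F {a} \ F {b}) ∩ (G {a} \ G {b})) = ∅ := by
    refine eq_empty_of_forall_notMem fun e he => ?_
    rw [mem_inter, mem_sdiff] at he
    exact he.1.2 (hDa (mem_inter.2 ⟨he.1.1, he.2⟩))
  have eb : (P \ refl P) ∩ refl ((F {b} \ F {a}) ∩ (G {b} \ G {a})) = ∅ := by
    refine eq_empty_of_forall_notMem fun e he => ?_
    rw [mem_inter, mem_sdiff] at he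
    exact he.1.2 (hDb (mem_inter.2 ⟨he.1.1, he.2⟩))
  rw [ea, eb, card_empty] at h
  push_cast at h
  linarith

/-- The refl-closed stratum again, as a special case of `triW_nonneg_of_deficit_free` (`refl P ⊆ P ⟹ P ⊆ refl P`). [this work] -/
theorem triW_nonneg_of_refl_subset' {β : Type} [DecidableEq β] [Fintype β] {a b : β} (hab : a ≠ b) (hu : (univ : Finset β) = {a, b})
    (P : Finset (Finset γ)) (F G : Finset β → Finset (Finset γ))
    (hP : IsUpperSet (P : Set (Finset γ))) (hF : ∀ x, IsUpperSet (F x : Set (Finset γ))) (hG : ∀ x, IsUpperSet (G x : Set (Finset γ)))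
    (hFm : Monotone F) (hGm : Monotone G) (hrP : refl P ⊆ P) : 0 ≤ triW P F G := by
  have hPr : P ⊆ refl P := by
    intro e he
    rw [mem_refl]
    exact hrP (mem_refl.2 (by rw [compl_compl]; exact he))
  exact triW_nonneg_of_deficit_free hab hu P F G hP hF hG hFm hGm (inter_subset_left.trans hPr) (inter_subset_left.trans hPr)

end FiveUpSet

end Summit.CriticalPhenomena.PercolationContinuityZ3.Theorems
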